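import Summits.CriticalPhenomena.SAWScalingLimit.Theses.SAWTrackTransport
import Summits.CriticalPhenomena.SAWScalingLimit.Theorems.SAWCompassLatticeCompassSLEYbCriterion
import Summits.CriticalPhenomena.SAWScalingLimit.Theorems.SAWDevelopingMapHexTransferThirdBdryEndpoints

/-!
# `YBtoUniform` (stmt-CriticalPhenomena-16966): the `δℤ²` endpoint hypothesis is load-bearing

Refuter crux-attack (vetting cycle 1), hypothesis mutation for the crux
`Summit.CriticalPhenomena.SAWScalingLimit.Theses.SAWTrackTransport.YBtoUniform`, companion of
`FalseWithoutYBApprox.lean`. Dropping the hypothesis `SAW.IsEndpointApprox D a b` makes the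
statement false (`ybtoUniform_false_without_sawApprox`, whose type is literally
`¬ (YBtoUniform with that binder removed)`): with the constant site family `a = b ≡ 0` every
`δℤ²` self-avoiding walk from `0` is drawn from `meshPoint δ 0 = 0`, so the bounded continuous
test function `γ ↦ min 1 ‖γ.source‖` integrates to `0` on the `δℤ²` side for EVERY `δ`, whereas on
the Yang–Baxter side (unit disc `(𝔻; 1, -1)`, a square-tiling endpoint approximation, which
exists by `ybEndpoints_of_mem_Icc`, laws eventually probability measures by the landed
`SAWCompassLatticeCompassSLE.eventually_isProbabilityMeasure_ybLaw`) it tends to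
`min 1 ‖pt 0‖ = 1`. Together with `FalseWithoutYBApprox.lean`: the two endpoint approximations
are each load-bearing — they are the only link between the two laws in the statement — and the
non-vacuity of both hypotheses for every Dobrushin domain is witnessed by the tree theorems used.
-/

noncomputable section

namespace Summit.CriticalPhenomena.SAWScalingLimit.Theorems.YBtoUniform.Negative

open MeasureTheory Filter Topology
open Literature.Probability.RandomPlanarGeometry Literature.Probability.RandomPlanarGeometry.SAW.YangBaxter
open Literature.Probability.LatticeModels

/-- **`SAW.IsEndpointApprox` is load-bearing in `YBtoUniform`**: the crux
`SAWTrackTransport.YBtoUniform` with the binder `SAW.IsEndpointApprox D a b →` deleted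
(everything else verbatim) is FALSE. Witness: `D = (𝔻; 1, -1)`, `a = b ≡ 0`, any square-tiling
Yang–Baxter endpoint approximation (`ybEndpoints_of_mem_Icc` at `π/2`), `f = min 1 ‖source‖`;
the difference of test integrals tends to `-1`, not `0`. [folklore] -/
theorem ybtoUniform_false_without_sawApprox :
    ¬ (∀ (D : DobrushinDomain) (a b : ℝ → Site 2) (a' b' : ℝ → MidEdge),
        IsYBEndpointApprox (fun (_ : ℤ) => Real.pi / 2) D a' b' →
        ∀ f : BoundedContinuousFunction (CurveClass ℂ) ℝ,
          Tendsto (fun δ : ℝ => (∫ γ, f γ.curve ∂(SAW.law D.carrier δ (a δ) (b δ))) -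
            ∫ γ, f (γ.curve (fun (_ : ℤ) => Real.pi / 2) δ)
              ∂(ybLaw (fun (_ : ℤ) => Real.pi / 2) D.carrier δ 1 (a' δ) (b' δ)))
            (𝓝[>] (0 : ℝ)) (𝓝 0)) := by
  intro h
  -- the test function `γ ↦ min 1 ‖γ.source‖`
  set F : BoundedContinuousFunction (CurveClass ℂ) ℝ :=
    BoundedContinuousFunction.mkOfBound
      ⟨fun γ => min 1 ‖γ.source‖,
        continuous_const.min (continuous_norm.comp CurveClass.continuous_source)⟩
      1 (fun γ₁ γ₂ => by
        simp only [ContinuousMap.coe_mk, Real.dist_eq]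
        have h1 : 0 ≤ min 1 ‖γ₁.source‖ := le_min zero_le_one (norm_nonneg _)
        have h2 : 0 ≤ min 1 ‖γ₂.source‖ := le_min zero_le_one (norm_nonneg _)
        have h3 : min 1 ‖γ₁.source‖ ≤ 1 := min_le_left _ _
        have h4 : min 1 ‖γ₂.source‖ ≤ 1 := min_le_left _ _
        rw [abs_le]; constructor <;> linarith) with hF_def
  have hF : ∀ γ : CurveClass ℂ, F γ = min 1 ‖γ.source‖ := fun γ => rfl
  -- a square-tiling Yang–Baxter endpoint approximation of the unit disc
  have hpi : Real.pi / 2 ∈ Set.Icc (Real.pi / 3) (2 * Real.pi / 3) := by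
    constructor <;> nlinarith [Real.pi_pos]
  obtain ⟨a', b', hab'⟩ :=
    Summit.CriticalPhenomena.SAWScalingLimit.Cruxes.HexTransfer.YbRelay.ybEndpoints_of_mem_Icc _ hpi
      DobrushinDomain.unitDisc
  have key := h DobrushinDomain.unitDisc (fun _ => 0) (fun _ => 0) a' b' hab' F
  -- the `δℤ²` side vanishes identically: every SAW from `0` is drawn from `meshPoint δ 0 = 0`
  have hmesh : ∀ δ : ℝ, meshPoint δ (0 : Site 2) = 0 := fun δ => by
    apply Complex.ext <;> simp
  have hSAW : ∀ δ : ℝ,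
      ∫ γ, F γ.curve ∂(SAW.law DobrushinDomain.unitDisc.carrier δ 0 0) = 0 := by
    intro δ
    have hzero : ∀ γ : SAW.DomainSAW DobrushinDomain.unitDisc.carrier δ 0 0, F γ.curve = 0 := by
      intro γ
      have hs : γ.curve.source = meshPoint δ 0 := by
        show (γ.walk.toCurve (meshPoint δ)) 0 = meshPoint δ 0
        exact SimpleGraph.Walk.toCurve_apply_zero _ _
      rw [hF, hs, hmesh, norm_zero]
      simp
    simp [hzero]
  -- the Yang–Baxter side is eventually `min 1 ‖δ · planeMidpoint (a' δ)‖`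
  have hYB : ∀ᶠ δ in 𝓝[>] (0 : ℝ),
      ∫ γ, F (γ.curve (fun (_ : ℤ) => Real.pi / 2) δ)
        ∂(ybLaw (fun (_ : ℤ) => Real.pi / 2) DobrushinDomain.unitDisc.carrier δ 1 (a' δ) (b' δ)) =
        min 1 ‖(δ : ℂ) * planeMidpoint (fun (_ : ℤ) => Real.pi / 2) (a' δ)‖ := by
    filter_upwards [Summit.CriticalPhenomena.SAWScalingLimit.Theorems.SAWCompassLatticeCompassSLE.eventually_isProbabilityMeasure_ybLaw
      DobrushinDomain.unitDisc hab'] with δ hP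
    have hconst : ∀ γ : YangBaxterSAW (fun (_ : ℤ) => Real.pi / 2)
        DobrushinDomain.unitDisc.carrier δ (a' δ) (b' δ),
        F (γ.curve (fun (_ : ℤ) => Real.pi / 2) δ) =
          min 1 ‖(δ : ℂ) * planeMidpoint (fun (_ : ℤ) => Real.pi / 2) (a' δ)‖ := by
      intro γ
      have hs : (γ.curve (fun (_ : ℤ) => Real.pi / 2) δ).source =
          (δ : ℂ) * planeMidpoint (fun (_ : ℤ) => Real.pi / 2) (a' δ) := by
        show (γ.path (fun (_ : ℤ) => Real.pi / 2) δ) 0 = _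
        exact YBWalk.path_apply_zero γ
      rw [hF, hs]
    simp [hconst]
  -- the first marked point of `(𝔻; 1, -1)` is `1`
  have hpt : DobrushinDomain.unitDisc.pt 0 = 1 := by
    show circleMap 0 1 (2 * Real.pi * ((![0, 1 / 2] : Fin 2 → ℝ) 0)) = 1
    simp [circleMap]
  -- hence the difference tends to `0 - min 1 ‖pt 0‖ = -1`
  have hlim : Tendsto (fun δ : ℝ => min 1 ‖(δ : ℂ) * planeMidpoint (fun (_ : ℤ) => Real.pi / 2) (a' δ)‖)
      (𝓝[>] (0 : ℝ)) (𝓝 (min 1 ‖DobrushinDomain.unitDisc.pt 0‖)) :=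
    ((continuous_const.min continuous_norm).tendsto _).comp hab'.tendsto_fst
  rw [hpt, norm_one, min_self] at hlim
  have hlim' : Tendsto (fun δ : ℝ =>
      (∫ γ, F γ.curve ∂(SAW.law DobrushinDomain.unitDisc.carrier δ ((fun _ : ℝ => (0 : Site 2)) δ)
          ((fun _ : ℝ => (0 : Site 2)) δ))) -
        ∫ γ, F (γ.curve (fun (_ : ℤ) => Real.pi / 2) δ)
          ∂(ybLaw (fun (_ : ℤ) => Real.pi / 2) DobrushinDomain.unitDisc.carrier δ 1 (a' δ) (b' δ)))
      (𝓝[>] (0 : ℝ)) (𝓝 (0 - 1)) := by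
    refine (tendsto_const_nhds.sub hlim).congr' ?_
    filter_upwards [hYB] with δ hδ
    rw [hδ, hSAW]
  have := tendsto_nhds_unique hlim' key
  norm_num at this

end Summit.CriticalPhenomena.SAWScalingLimit.Theorems.YBtoUniform.Negative
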